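import Summits.AnomalousDissipation.AnomalousDissipation.Theorems.UniformResolution.Negative.SteadyStates
import Summits.AnomalousDissipation.AnomalousDissipation.Theorems.QuarticGate.Negative.Laminar
import Literature.Analysis.FluidPDE.SteadyGalerkinApprox
import Literature.Analysis.FunctionSpaces.TorusClassicalNSUniqueness

/-!
# `MomentParity.ResolvedDissipation` (stmt-AnomalousDissipation-14284), line `enstrophy-ui-transfer`:
# the laminar corner of the hard stub, III — small forces have sup-small Galerkin steady states, uniformly in `N`

Supports stmt-AnomalousDissipation-14284 (helper of the line lead; nothing here closes an item).

`exists_small_galerkinSteady`: for `ν > 0` and a smooth force with `∫‖f‖² ≤ ν⁴/16`, at EVERY Galerkin level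
`N` there is a level-`N` Galerkin steady state `s ∈ H` (every level-`N` band test annihilates `⟨F(s), ·⟩`) with
`‖s̄(x)‖ ≤ ν` for all `x` (`s̄ = P_N s`) and `‖∇s‖² ≤ ν²` — constants independent of `N`. Existence is the
tree's `Literature.Analysis.FluidPDE.exists_steady_galerkin_approx` (Temam 1979 Ch. II Thm. 1.2 at Galerkin
level: Brouwer + a priori bound `(4π²ν)²Σ|k|²‖C k‖² ≤ ∫‖f‖²` + the tested Galerkin equations); the sup bound
is the dyadic Agmon inequality of `Theorems/UniformResolution/Negative/Agmon.lean` at the cut `i₀ = 0`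
together with the `H²` bootstrap from the Galerkin equation tested with `Δs̄`
(`ν‖Δs̄‖² ≤ ‖f‖‖Δs̄‖ + ‖s̄‖_∞‖∇s̄‖‖Δs̄‖`). Combined with part II (`…SmallDataDirac`): for such forces every
admissible law at every level is `δ_s`, so the hard stub U holds with `M = ν²`.
-/

noncomputable section

-- `Summit.<Summit>.<Problem>`: single-conjunct summit, the duplicate namespace segment is mandated.
set_option linter.dupNamespace false

namespace Summit.AnomalousDissipation.AnomalousDissipation.Theorems.MomentParityResolvedDissipation

open MeasureTheory Filter Topology
open scoped ENNReal InnerProductSpace RealInnerProductSpace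
open Literature.Analysis.FunctionSpaces Literature.Analysis.FluidPDE
open Summit.AnomalousDissipation.AnomalousDissipation.Theses.MomentParity
open Summit.AnomalousDissipation.AnomalousDissipation.Theorems.CubicParityLoud.Negative (T3 R3 H3 L2T3)
open Summit.AnomalousDissipation.AnomalousDissipation.Theorems.QuarticGate.Negative
  (IsLevel IsBandTest polyGrad IsPolyStationary)
open Summit.AnomalousDissipation.AnomalousDissipation.Theorems.UniformResolution.Negative
  (IsGalerkinSteady coef trunc trunc_eq norm_realTrigPoly_le_agmon integral_norm_sq_convect_self_le
    integral_sum_norm_sq_partialDeriv_realTrigPoly integral_norm_sq_laplacian_realTrigPoly isConjSymm_lapCoeff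
    abs_integral_inner_le_weighted)

/-! ## The real arithmetic of the sup bound, isolated -/

/-- The real arithmetic of the small-data sup bound: with `a = (Σ|k|²‖C k‖²)^{1/2}`, `b = (Σ|k|⁴‖C k‖²)^{1/2}`,
the a priori bound `(4π²ν)²a² ≤ F² ≤ ν⁴/16`, the `H²` row `8π⁴ν²b² ≤ F² + Cv` and the convection bound
`Cv ≤ (√384 a + √128 b)²·4π²a²` force `√384 a + √128 b ≤ ν`. [folklore] -/
theorem smallData_algebra {ν a b F2 Cv : ℝ} (hν : 0 < ν) (ha : 0 ≤ a) (hb : 0 ≤ b)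
    (hF : F2 ≤ ν ^ 4 / 16) (hP : (4 * Real.pi ^ 2 * ν) ^ 2 * a ^ 2 ≤ F2)
    (hQ : 8 * Real.pi ^ 4 * ν ^ 2 * b ^ 2 ≤ F2 + Cv)
    (hCv : Cv ≤ (Real.sqrt 384 * a + Real.sqrt 128 * b) ^ 2 * (4 * Real.pi ^ 2 * a ^ 2)) :
    Real.sqrt 384 * a + Real.sqrt 128 * b ≤ ν := by
  have hpi3 : 3 < Real.pi := Real.pi_gt_three
  have hα : Real.sqrt 384 ≤ 20 := by
    rw [Real.sqrt_le_left (by norm_num)]; norm_num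
  have hβ : Real.sqrt 128 ≤ 12 := by
    rw [Real.sqrt_le_left (by norm_num)]; norm_num
  have hαα : Real.sqrt 384 ^ 2 = 384 := Real.sq_sqrt (by norm_num)
  have hββ : Real.sqrt 128 ^ 2 = 128 := Real.sq_sqrt (by norm_num)
  have hπ2 : 9 < Real.pi ^ 2 := by nlinarith
  have hπ4 : 81 < Real.pi ^ 4 := by nlinarith
  have hν2 : 0 < ν ^ 2 := by positivity
  -- Step 1: `256π⁴ a² ≤ ν²`, hence `20736 a² ≤ ν²` and `2304π² a² ≤ ν²`
  have h1 : 256 * Real.pi ^ 4 * a ^ 2 ≤ ν ^ 2 := by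
    have e1 : ν ^ 2 * (256 * Real.pi ^ 4 * a ^ 2) ≤ ν ^ 2 * ν ^ 2 := by linarith
    exact le_of_mul_le_mul_left e1 hν2
  have hA : 20736 * a ^ 2 ≤ ν ^ 2 := by
    have := mul_le_mul_of_nonneg_right hπ4.le (by positivity : (0:ℝ) ≤ 256 * a ^ 2)
    linarith
  have hB : 2304 * Real.pi ^ 2 * a ^ 2 ≤ ν ^ 2 := by
    have := mul_le_mul_of_nonneg_right hπ2.le (by positivity : (0:ℝ) ≤ 256 * Real.pi ^ 2 * a ^ 2)
    linarith
  -- Step 2: the convection constant `288 Cv ≤ ν²(384a² + 128b²)`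
  have hX0 : (0:ℝ) ≤ 384 * a ^ 2 + 128 * b ^ 2 := by positivity
  have h2 : Cv ≤ 8 * Real.pi ^ 2 * a ^ 2 * (384 * a ^ 2 + 128 * b ^ 2) := by
    have e384 : Real.sqrt 384 ^ 2 * a ^ 2 = 384 * a ^ 2 := by rw [hαα]
    have e128 : Real.sqrt 128 ^ 2 * b ^ 2 = 128 * b ^ 2 := by rw [hββ]
    have sq := sq_nonneg (Real.sqrt 384 * a - Real.sqrt 128 * b)
    have e : (Real.sqrt 384 * a + Real.sqrt 128 * b) ^ 2 ≤ 2 * (384 * a ^ 2 + 128 * b ^ 2) := by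
      nlinarith
    have h4 : 0 ≤ 4 * Real.pi ^ 2 * a ^ 2 := by positivity
    have := mul_le_mul_of_nonneg_right e h4
    linarith
  have h3 : 288 * Cv ≤ ν ^ 2 * (384 * a ^ 2 + 128 * b ^ 2) := by
    have h8 : 288 * (8 * Real.pi ^ 2 * a ^ 2) ≤ ν ^ 2 := by linarith
    have := mul_le_mul_of_nonneg_right h8 hX0
    nlinarith
  -- Step 3: bound `b²`
  have hC : 648 * ν ^ 2 * b ^ 2 ≤ 8 * Real.pi ^ 4 * ν ^ 2 * b ^ 2 := by
    have := mul_le_mul_of_nonneg_right hπ4.le (by positivity : (0:ℝ) ≤ 8 * ν ^ 2 * b ^ 2)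
    linarith
  have hE : 384 * a ^ 2 ≤ ν ^ 2 / 54 := by
    rw [le_div_iff₀ (by norm_num)]
    linarith
  have hG : ν ^ 2 * (384 * a ^ 2) ≤ ν ^ 2 * (ν ^ 2 / 54) := mul_le_mul_of_nonneg_left hE hν2.le
  have h4 : ν ^ 2 * (10000 * b ^ 2) ≤ ν ^ 2 * ν ^ 2 := by nlinarith
  have h4' : 10000 * b ^ 2 ≤ ν ^ 2 := le_of_mul_le_mul_left h4 hν2
  -- Step 4: conclude
  have ha' : a ≤ ν / 144 := by
    have : a ^ 2 ≤ (ν / 144) ^ 2 := by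
      rw [div_pow, le_div_iff₀ (by norm_num)]
      linarith
    exact (pow_le_pow_iff_left₀ ha (by positivity) two_ne_zero).1 this
  have hb' : b ≤ ν / 100 := by
    have : b ^ 2 ≤ (ν / 100) ^ 2 := by
      rw [div_pow, le_div_iff₀ (by norm_num)]
      linarith
    exact (pow_le_pow_iff_left₀ hb (by positivity) two_ne_zero).1 this
  have m1 := mul_le_mul hα ha' ha (by norm_num : (0:ℝ) ≤ 20)
  have m2 := mul_le_mul hβ hb' hb (by norm_num : (0:ℝ) ≤ 12)
  linarith

/-! ## Existence of a sup-small steady state at every level -/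

/-- **Small forces have sup-small Galerkin steady states, uniformly in the level.** For `ν > 0` and a smooth
force `f` with `∫‖f‖² ≤ ν⁴/16`, at every level `N` there is `s ∈ H`, level-`N` and Galerkin-steady at `(ν, f)`
(every level-`N` band test annihilates `⟨F(s), ·⟩`), with `‖(P_N s)(x)‖ ≤ ν` for all `x` and `‖∇s‖² ≤ ν²`.
[cite: Temam1979, Ch. II Thm. 1.2–1.3 (Galerkin level)] -/
theorem exists_small_galerkinSteady :
    ∀ {ν : ℝ}, 0 < ν → ∀ {f : T3 → R3}, Torus.IsSmooth f → ∫ x, ‖f x‖ ^ 2 ≤ ν ^ 4 / 16 → ∀ (N : ℕ),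
    ∃ s : H3, IsLevel N s ∧ IsGalerkinSteady ν f N s ∧ (∀ x, ‖trunc N s x‖ ≤ ν) ∧
      Torus.eGradNormSq ((s.1 : L2T3) : T3 → R3) ≤ ENNReal.ofReal (ν ^ 2) := by
  intro ν hν f hf hsmall N
  set S : Finset (Fin 3 → ℤ) := (Torus.freqBall N).erase 0 with hSdef
  have hS : ∀ k ∈ S, -k ∈ S := Literature.Analysis.FluidPDE.neg_mem_freqBall_erase_zero
  have hS0 : (0 : Fin 3 → ℤ) ∉ S := by simp [hSdef]
  obtain ⟨C, hCsymm, hCT, hCsupp, hapr, -, hgal⟩ :=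
    Literature.Analysis.FluidPDE.exists_steady_galerkin_approx hν (hf.memLp 2) N
  -- the steady field and its class in `H`
  set sb : T3 → R3 := Torus.realTrigPoly S C with hsb
  have hsm : Torus.IsSmooth sb := Torus.isSmooth_realTrigPoly _ _
  have hT : Torus.IsTransversal S C := fun k _ => hCT k
  have hdiv : Torus.IsDivFree sb := Torus.isDivFree_realTrigPoly hT
  have hzm : Torus.HasZeroMean sb := Literature.Analysis.FluidPDE.hasZeroMean_realTrigPoly_of_zero_not_mem hS0 C
  let sH : H3 := ⟨(hsm.memLp 2).toLp sb,
    Torus.smoothSolenoidal_subset_energySpace ⟨sb, hsm, hdiv, hzm, MemLp.coeFn_toLp (hsm.memLp 2)⟩⟩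
  have hae : ((sH.1 : L2T3) : T3 → R3) =ᵐ[volume] sb := MemLp.coeFn_toLp (hsm.memLp 2)
  have hC0 : C 0 = 0 := hCsupp 0 hS0
  -- Fourier coefficients of the class
  have hcoef : ∀ k, coef sH k = C k := by
    intro k
    change UnitAddTorus.mFourierCoeff (EuclideanSpace.complexify ∘ ((sH.1 : L2T3) : T3 → R3)) k = C k
    rw [QuarticGate.Negative.mFourierCoeff_congr_ae hae, hsb, Torus.mFourierCoeff_realTrigPoly hS hCsymm]
    by_cases hk : k ∈ S
    · rw [if_pos hk]
    · rw [if_neg hk, hCsupp k hk]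
  have hlev : IsLevel N sH := by
    intro k hk
    change coef sH k = 0
    rw [hcoef k]
    exact hCsupp k hk
  -- the truncation of the class is the steady field
  have htrunc : trunc N sH = sb := by
    rw [trunc_eq, hsb]
    have e1 : Torus.realTrigPoly (Torus.freqBall N) (coef sH) = Torus.realTrigPoly (Torus.freqBall N) C :=
      Torus.realTrigPoly_congr fun k _ => hcoef k
    rw [e1]
    -- dropping the zero mode does not change the polynomial (`C 0 = 0`)
    funext x
    rw [Torus.realTrigPoly_apply_eq_sum, Torus.realTrigPoly_apply_eq_sum, hSdef]
    by_cases h0 : (0 : Fin 3 → ℤ) ∈ Torus.freqBall N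
    · rw [← Finset.sum_erase_add _ _ h0, hC0, smul_zero, map_zero, add_zero]
    · rw [Finset.erase_eq_of_notMem h0]
  -- Galerkin steadiness via the flux form of the generator
  have hsteady : IsGalerkinSteady ν f N sH := by
    intro w hw
    rw [Torus.nsGeneratorPairing_eq_flux ν (hf.memLp 2) hw.1 hae]
    exact hgal w hw.1 hw.2.1 hw.2.2.2
  -- the numbers
  set P : ℝ := ∑ k ∈ S, Torus.freqNormSq k * ‖C k‖ ^ 2 with hPdef
  set Q : ℝ := ∑ k ∈ S, Torus.freqNormSq k ^ 2 * ‖C k‖ ^ 2 with hQdef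
  have hP0 : 0 ≤ P := Finset.sum_nonneg fun k _ => mul_nonneg (Torus.freqNormSq_nonneg _) (sq_nonneg _)
  have hQ0 : 0 ≤ Q := Finset.sum_nonneg fun k _ => mul_nonneg (sq_nonneg _) (sq_nonneg _)
  set a : ℝ := Real.sqrt P with hadef
  set b : ℝ := Real.sqrt Q with hbdef
  have ha0 : 0 ≤ a := Real.sqrt_nonneg _
  have hb0 : 0 ≤ b := Real.sqrt_nonneg _
  have haa : a ^ 2 = P := Real.sq_sqrt hP0
  have hbb : b ^ 2 = Q := Real.sq_sqrt hQ0
  -- Agmon at the cut `i₀ = 0`: `‖s̄(x)‖ ≤ √384 a + √128 b`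
  have hAg : ∀ x, ‖sb x‖ ≤ Real.sqrt 384 * a + Real.sqrt 128 * b := by
    intro x
    have h := norm_realTrigPoly_le_agmon S hC0 0 x
    simp only [pow_zero, mul_one] at h
    exact h
  -- gradient and Laplacian norms of `s̄`
  have hgrad : ∫ x, ∑ j, ‖Torus.partialDeriv j sb x‖ ^ 2 = 4 * Real.pi ^ 2 * P :=
    integral_sum_norm_sq_partialDeriv_realTrigPoly hS hCsymm
  have hlap : ∫ x, ‖Torus.laplacian sb x‖ ^ 2 = 16 * Real.pi ^ 4 * Q :=
    integral_norm_sq_laplacian_realTrigPoly hS hCsymm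
  -- the Galerkin equation tested with `Δs̄` (a level-`N` band test)
  have hΔ : Torus.laplacian sb = Torus.realTrigPoly S (fun k => -((((4 * Real.pi ^ 2 * Torus.freqNormSq k : ℝ)) : ℂ) • C k)) :=
    funext fun x => Torus.laplacian_realTrigPoly S C x
  have hΔsm : Torus.IsSmooth (Torus.laplacian sb) := hsm.laplacian
  have hΔdiv : Torus.IsDivFree (Torus.laplacian sb) := by
    rw [hΔ]
    refine Torus.isDivFree_realTrigPoly fun k hk => ?_
    simp only [PiLp.neg_apply, PiLp.smul_apply, smul_eq_mul, mul_neg, Finset.sum_neg_distrib, neg_eq_zero]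
    calc ∑ j, (k j : ℂ) * ((((4 * Real.pi ^ 2 * Torus.freqNormSq k : ℝ)) : ℂ) * C k j)
        = (((4 * Real.pi ^ 2 * Torus.freqNormSq k : ℝ)) : ℂ) * ∑ j, (k j : ℂ) * C k j := by
          rw [Finset.mul_sum]; exact Finset.sum_congr rfl fun j _ => by ring
      _ = 0 := by rw [hCT k, mul_zero]
  have hΔband : ∀ k ∉ (Torus.freqBall N).erase 0,
      UnitAddTorus.mFourierCoeff (EuclideanSpace.complexify ∘ Torus.laplacian sb) k = 0 := by
    intro k hk
    rw [hΔ, Torus.mFourierCoeff_realTrigPoly hS (isConjSymm_lapCoeff hCsymm), if_neg]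
    exact hk
  have hrow := hgal (Torus.laplacian sb) hΔsm hΔdiv hΔband
  -- read the row: `ν ∫‖Δs̄‖² = ∫⟪f, Δs̄⟫ + ∫⟪(s̄·∇)s̄ ... ⟫`; precisely
  -- `∫⟪s̄, (s̄·∇)Δs̄⟫ + ν∫⟪s̄, ΔΔs̄⟫ + ∫⟪f, Δs̄⟫ = 0`
  have i1 : Integrable (fun x => ⟪sb x, Torus.convect sb (Torus.laplacian sb) x⟫_ℝ) volume :=
    (hsm.inner (hsm.convect hΔsm)).integrable
  have i2 : Integrable (fun x => ν * ⟪sb x, Torus.laplacian (Torus.laplacian sb) x⟫_ℝ) volume :=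
    ((hsm.inner hΔsm.laplacian).integrable).const_mul ν
  have i3 : Integrable (fun x => ⟪f x, Torus.laplacian sb x⟫_ℝ) volume := (hf.inner hΔsm).integrable
  have i12 : Integrable (fun x => ⟪sb x, Torus.convect sb (Torus.laplacian sb) x⟫_ℝ +
      ν * ⟪sb x, Torus.laplacian (Torus.laplacian sb) x⟫_ℝ) volume := i1.add i2
  rw [integral_add i12 i3, integral_add i1 i2, integral_const_mul] at hrow
  -- the three terms
  have tL : ∫ x, ⟪sb x, Torus.laplacian (Torus.laplacian sb) x⟫_ℝ = 16 * Real.pi ^ 4 * Q := by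
    rw [← Torus.integral_inner_laplacian_comm hsm hΔsm, ← hlap]
    exact integral_congr_ae (ae_of_all _ fun x => real_inner_self_eq_norm_sq _)
  have tT : ∫ x, ⟪sb x, Torus.convect sb (Torus.laplacian sb) x⟫_ℝ =
      -∫ x, ⟪Torus.convect sb sb x, Torus.laplacian sb x⟫_ℝ := by
    rw [Torus.integral_inner_convect_eq_neg hsm hdiv hsm hΔsm, neg_neg]
  -- Young twice (weight `2/ν`)
  have hw : (0 : ℝ) < 2 / ν := by positivity
  have Y1 := abs_integral_inner_le_weighted (hf.memLp 2) (hΔsm.memLp 2) hw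
  have Y2 := abs_integral_inner_le_weighted ((hsm.convect hsm).memLp 2) (hΔsm.memLp 2) hw
  rw [hlap, show (2 / ν)⁻¹ = ν / 2 by rw [inv_div]] at Y1 Y2
  -- convection bound with the Agmon sup bound
  have hconv := integral_norm_sq_convect_self_le hsm hAg
  rw [hgrad] at hconv
  -- assemble the real inequalities
  have hQrow : 8 * Real.pi ^ 4 * ν ^ 2 * b ^ 2 ≤ (∫ x, ‖f x‖ ^ 2) + ∫ x, ‖Torus.convect sb sb x‖ ^ 2 := by
    rw [hbb]
    set Cv' : ℝ := ∫ x, ‖Torus.convect sb sb x‖ ^ 2 with hCv'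
    set F2' : ℝ := ∫ x, ‖f x‖ ^ 2 with hF2'
    have e : ν * (16 * Real.pi ^ 4 * Q) = (∫ x, ⟪Torus.convect sb sb x, Torus.laplacian sb x⟫_ℝ) -
        ∫ x, ⟪f x, Torus.laplacian sb x⟫_ℝ := by rw [tL, tT] at hrow; linarith only [hrow]
    have b1 := (le_abs_self _).trans Y2
    have b2 := (neg_le_abs _).trans Y1
    -- `ν L ≤ (c/2)(Cv' + F2') + (ν/2) L` with `c = 2/ν`, `c ν = 2`, `L = 16π⁴ Q`
    have k1 : ν * (16 * Real.pi ^ 4 * Q) ≤ 2⁻¹ * (2 / ν * Cv' + ν / 2 * (16 * Real.pi ^ 4 * Q)) +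
        2⁻¹ * (2 / ν * F2' + ν / 2 * (16 * Real.pi ^ 4 * Q)) := by linarith only [e, b1, b2]
    have k2 := mul_le_mul_of_nonneg_left k1 hν.le
    have k3 : ν * (2⁻¹ * (2 / ν * Cv' + ν / 2 * (16 * Real.pi ^ 4 * Q)) +
        2⁻¹ * (2 / ν * F2' + ν / 2 * (16 * Real.pi ^ 4 * Q))) =
        Cv' + F2' + ν * ν * (16 * Real.pi ^ 4 * Q) / 2 := by
      field_simp
      ring
    rw [k3] at k2
    linarith only [k2]
  have hPapr : (4 * Real.pi ^ 2 * ν) ^ 2 * a ^ 2 ≤ ∫ x, ‖f x‖ ^ 2 := by rw [haa]; exact hapr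
  have key := smallData_algebra hν ha0 hb0 hsmall hPapr hQrow (by rw [haa]; exact hconv)
  -- conclude
  refine ⟨sH, hlev, hsteady, fun x => ?_, ?_⟩
  · rw [htrunc]
    exact (hAg x).trans key
  · have hZ : Torus.eGradNormSq ((sH.1 : L2T3) : T3 → R3) = ENNReal.ofReal (4 * Real.pi ^ 2 * P) := by
      rw [QuarticGate.Negative.eGradNormSq_congr_ae hae]
      exact Torus.eGradNormSq_realTrigPoly hS hCsymm
    rw [hZ]
    refine ENNReal.ofReal_le_ofReal ?_
    -- `4π² P ≤ 4π² F²/(16π⁴ν²) ≤ ν²`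
    have hpi3 : 3 < Real.pi := Real.pi_gt_three
    have hν2 : 0 < ν ^ 2 := by positivity
    have h1 : 16 * Real.pi ^ 4 * ν ^ 2 * P ≤ ν ^ 4 / 16 := by linarith only [hapr.trans hsmall]
    have h64 : (1 : ℝ) ≤ 64 * Real.pi ^ 2 := by nlinarith only [hpi3]
    have hx : (0 : ℝ) ≤ 4 * Real.pi ^ 2 * ν ^ 2 * P := by positivity
    have h2 := mul_le_mul_of_nonneg_right h64 hx
    have h3 : ν ^ 2 * (4 * Real.pi ^ 2 * P) ≤ ν ^ 2 * ν ^ 2 := by linarith only [h1, h2]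
    exact le_of_mul_le_mul_left h3 hν2

end Summit.AnomalousDissipation.AnomalousDissipation.Theorems.MomentParityResolvedDissipation

end
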